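import Literature.NumberTheory.GaloisRepresentations.ContinuousCupProduct
import HarnessLib

/-!
# Continuous cohomology in degree two: inhomogeneous cocycles

Mathlib's continuous group cohomology `continuousCohomology n X` (`X : TopRep R G`) is the homology
of the complex of `G`-invariant homogeneous continuous cochains `C(G, C(G, ⋯ C(G, X)))` and comes
with no element-level description beyond degree `0` (Mathlib) and degree `1` (the tree's
`ContinuousH1.lean`: continuous crossed homomorphisms).  This file gives the classical description
of `H²_cont(G, X)` by **continuous inhomogeneous `2`-cocycles** ("`H²(G, A)` est le groupe des
classes de systèmes de facteurs continus de `G` dans `A`", Serre, *Cohomologie galoisienne*,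
I §2.3, with the cochains of I §2.2; Neukirch–Schmidt–Wingberg, *Cohomology of Number Fields*,
I §2 and II §7 for continuous cochains), for a locally compact topological group `G` and an
arbitrary topological representation `X`:

* `contTwoCocycles X` — continuous `f : G × G → X` with
  `σ f(τ, υ) - f(στ, υ) + f(σ, τυ) - f(σ, τ) = 0`;
* `toTwoCochain X f` — the attached `G`-invariant homogeneous `2`-cochain
  `F(x, y, z) = x f(x⁻¹y, y⁻¹z)`, written in the action-free form
  `f(y, y⁻¹z) - f(x, x⁻¹z) + f(x, x⁻¹y)` (equal to it by the cocycle identity,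
  `toTwoCochain_apply_eq_smul`), so that no joint continuity of the action is needed; `d F = 0`;
* `twoCocycleClass X f ∈ H²_cont(G, X)` — its class; additive and `R`-linear
  (`twoCocycleClassₗ`), **surjective** (`twoCocycleClass_surjective`: the inhomogeneous cocycle of
  an invariant homogeneous cocycle `F` is `f(σ, τ) = F(1, σ, στ)`), with kernel the **coboundaries
  of continuous `1`-cochains** (`twoCocycleClass_eq_zero_iff`:
  `[f] = 0 ↔ ∃ b : C(G, X), f(σ, τ) = σ b(τ) - b(στ) + b(σ)`), and functorial along compatible
  pairs (`map_twoCocycleClass`: `H²(θ, φ)[f] = [φ ∘ f ∘ (θ × θ)]`);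
* the link with the tree's cup product `H¹ × H¹ → H²` (`ContinuousCupProduct.lean`): the cup
  product of two continuous crossed homomorphisms is the class of the inhomogeneous `2`-cocycle
  `(σ, τ) ↦ ⟨f σ, σ g τ⟩ = ⟨f σ, g(στ) - g σ⟩` (`ContPairing.cupCocycle`,
  `ContPairing.cupTwoCochain_eq_toTwoCochain`, `ContPairing.cupClass_eq_twoCocycleClass`).

This is the degree-`2` element-level API on which connecting homomorphisms `H¹ → H²`, explicit
`2`-cocycles (cyclic "carry" cocycles, Brauer classes) and cup-product identities are computed.

## References

* J.-P. Serre, *Cohomologie galoisienne*, 5e éd., LNM 5 (1994) / *Galois Cohomology* (1997),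
  I §2.2 (continuous cochains), I §2.3 (`H²` = classes of continuous factor systems).
  [SerreGaloisCohomology1997]
* J. Neukirch, A. Schmidt, K. Wingberg, *Cohomology of Number Fields*, 2nd ed. (2008), I §2,
  II §7. [NeukirchSchmidtWingberg2008]
-/

noncomputable section

open CategoryTheory Limits Function

universe u v

namespace Literature.NumberTheory.GaloisRepresentations

open TopRep ContRepresentation ContinuousCohomology

set_option allowUnsafeReducibility true in
attribute [local reducible] CategoryTheory.Functor.mapHomologicalComplex

/-! ### Continuous inhomogeneous `2`-cocycles -/

section TwoCocycles

variable {R : Type u} [CommRing R] [TopologicalSpace R]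
variable {G : Type v} [Group G] [TopologicalSpace G] [IsTopologicalGroup G]
variable (X : TopRep.{v} R G)

/-- The `R`-module of **continuous inhomogeneous `2`-cocycles** of a topological representation
`X`: continuous `f : G × G → X` with `σ f(τ, υ) + f(σ, τυ) = f(στ, υ) + f(σ, τ)`, i.e.
`σ f(τ, υ) - f(στ, υ) + f(σ, τυ) - f(σ, τ) = 0`.
Ref: Serre, *Cohomologie galoisienne*, I §2.3 ("systèmes de facteurs continus");
Neukirch–Schmidt–Wingberg (2008), I §2. [folklore] -/
def contTwoCocycles : Submodule R C(G × G, X) where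
  carrier := {f | ∀ σ τ υ : G, X.ρ σ (f (τ, υ)) + f (σ, τ * υ) = f (σ * τ, υ) + f (σ, τ)}
  zero_mem' σ τ υ := by simp
  add_mem' {a b} ha hb σ τ υ := by
    simp only [ContinuousMap.add_apply, map_add]
    rw [add_add_add_comm, ha σ τ υ, hb σ τ υ, add_add_add_comm]
  smul_mem' r a ha σ τ υ := by
    simp only [ContinuousMap.smul_apply, map_smul, ← smul_add, ha σ τ υ]

omit [IsTopologicalGroup G] in
variable {X} in
/-- Membership in `contTwoCocycles`: the `2`-cocycle identity. [folklore] -/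
theorem mem_contTwoCocycles_iff (f : C(G × G, X)) :
    f ∈ contTwoCocycles X ↔
      ∀ σ τ υ : G, X.ρ σ (f (τ, υ)) + f (σ, τ * υ) = f (σ * τ, υ) + f (σ, τ) :=
  Iff.rfl

namespace contTwoCocycles

omit [IsTopologicalGroup G] in
variable {X} in
/-- The `2`-cocycle identity solved for `σ f(τ, υ)`. [folklore] -/
theorem smul_apply (f : contTwoCocycles X) (σ τ υ : G) :
    X.ρ σ (f.1 (τ, υ)) = f.1 (σ * τ, υ) + f.1 (σ, τ) - f.1 (σ, τ * υ) := by
  rw [eq_sub_iff_add_eq, f.2 σ τ υ]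

omit [IsTopologicalGroup G] in
variable {X} in
/-- `f(1, τ) = f(1, 1)` for a `2`-cocycle `f`. [folklore] -/
theorem apply_one_left (f : contTwoCocycles X) (τ : G) : f.1 (1, τ) = f.1 (1, 1) := by
  have h := f.2 1 1 τ
  rw [_root_.map_one, one_mul, one_mul, one_apply_eq_self, add_comm] at h
  exact add_left_cancel h

omit [IsTopologicalGroup G] in
variable {X} in
/-- `f(σ, 1) = σ f(1, 1)` for a `2`-cocycle `f`. [folklore] -/
theorem apply_one_right (f : contTwoCocycles X) (σ : G) : f.1 (σ, 1) = X.ρ σ (f.1 (1, 1)) := by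
  have h := f.2 σ 1 1
  rw [mul_one, mul_one] at h
  exact (add_right_cancel h).symm

end contTwoCocycles

/-- The function `(x, y, z) ↦ f(y, y⁻¹z) - f(x, x⁻¹z) + f(x, x⁻¹y)` attached to a continuous
function of two variables, as a continuous function of three variables (for a `2`-cocycle this is
the homogeneous cochain `x f(x⁻¹y, y⁻¹z)`, see `toTwoCochain_apply_eq_smul`). [folklore] -/
def homogeneousFun₂ (f : C(G × G, X)) : C(G × G × G, X) where
  toFun p := f (p.2.1, p.2.1⁻¹ * p.2.2) - f (p.1, p.1⁻¹ * p.2.2) + f (p.1, p.1⁻¹ * p.2.1)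
  continuous_toFun := by fun_prop

/-- Unfolding `homogeneousFun₂`. [folklore] -/
@[simp] theorem homogeneousFun₂_apply (f : C(G × G, X)) (x y z : G) :
    homogeneousFun₂ X f (x, y, z) = f (y, y⁻¹ * z) - f (x, x⁻¹ * z) + f (x, x⁻¹ * y) := rfl

omit [TopologicalSpace G] [IsTopologicalGroup G] in
/-- `(s⁻¹x)⁻¹(s⁻¹y) = x⁻¹y`. [folklore] -/
theorem inv_mul_inv_mul_inv_mul (s x y : G) : (s⁻¹ * x)⁻¹ * (s⁻¹ * y) = x⁻¹ * y := by
  rw [mul_inv_rev, inv_inv, mul_assoc, mul_inv_cancel_left]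

omit [TopologicalSpace G] [IsTopologicalGroup G] in
/-- `x⁻¹y · y⁻¹z = x⁻¹z`. [folklore] -/
theorem inv_mul_mul_inv_mul (x y z : G) : x⁻¹ * y * (y⁻¹ * z) = x⁻¹ * z := by
  rw [mul_assoc, mul_inv_cancel_left]

variable [LocallyCompactSpace G]

/-- **The invariant homogeneous `2`-cochain of a continuous inhomogeneous `2`-cocycle**:
`F(x, y, z) = f(y, y⁻¹z) - f(x, x⁻¹z) + f(x, x⁻¹y)` (`= x f(x⁻¹y, y⁻¹z)`); it is `G`-invariant.
Ref: Serre, *Galois Cohomology*, I §2.2. [folklore] -/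
def toTwoCochain (f : contTwoCocycles X) : (homogeneousCochains X).X 2 :=
  ⟨nest₃ X (homogeneousFun₂ X f.1), by
    rw [ContRepresentation.mem_invariants]
    intro s
    refine ContinuousMap.ext fun x => ContinuousMap.ext fun y => ContinuousMap.ext fun z => ?_
    rw [resolutionX_three_ρ_apply, nest₃_apply, nest₃_apply, homogeneousFun₂_apply,
      homogeneousFun₂_apply]
    rw [inv_mul_inv_mul_inv_mul, inv_mul_inv_mul_inv_mul, inv_mul_inv_mul_inv_mul, map_add,
      map_sub, contTwoCocycles.smul_apply, contTwoCocycles.smul_apply,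
      contTwoCocycles.smul_apply]
    simp only [mul_inv_cancel_left, inv_mul_mul_inv_mul]
    abel⟩

/-- Unfolding `toTwoCochain` on elements. [folklore] -/
@[simp] theorem toTwoCochain_apply (f : contTwoCocycles X) (x y z : G) :
    ((toTwoCochain X f : (homogeneousCochains X).X 2) : C(G, C(G, C(G, X)))) x y z =
      f.1 (y, y⁻¹ * z) - f.1 (x, x⁻¹ * z) + f.1 (x, x⁻¹ * y) := rfl

/-- The homogeneous cochain of `f` is `(x, y, z) ↦ x f(x⁻¹y, y⁻¹z)` (the classical dictionary
between inhomogeneous and homogeneous cochains). [cite: SerreGaloisCohomology1997, I §2.2] -/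
theorem toTwoCochain_apply_eq_smul (f : contTwoCocycles X) (x y z : G) :
    ((toTwoCochain X f : (homogeneousCochains X).X 2) : C(G, C(G, C(G, X)))) x y z =
      X.ρ x (f.1 (x⁻¹ * y, y⁻¹ * z)) := by
  rw [toTwoCochain_apply, contTwoCocycles.smul_apply, mul_inv_cancel_left, inv_mul_mul_inv_mul]
  abel

/-- Additivity of `toTwoCochain`. [folklore] -/
theorem toTwoCochain_add (f g : contTwoCocycles X) :
    toTwoCochain X (f + g) = toTwoCochain X f + toTwoCochain X g := by
  refine Subtype.ext (ContinuousMap.ext fun x => ContinuousMap.ext fun y =>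
    ContinuousMap.ext fun z => ?_)
  change homogeneousFun₂ X (f.1 + g.1) (x, y, z) =
    homogeneousFun₂ X f.1 (x, y, z) + homogeneousFun₂ X g.1 (x, y, z)
  simp only [homogeneousFun₂_apply, ContinuousMap.add_apply]
  abel

/-- Linearity of `toTwoCochain`. [folklore] -/
theorem toTwoCochain_smul (r : R) (f : contTwoCocycles X) :
    toTwoCochain X (r • f) = r • toTwoCochain X f := by
  refine Subtype.ext (ContinuousMap.ext fun x => ContinuousMap.ext fun y =>
    ContinuousMap.ext fun z => ?_)
  change homogeneousFun₂ X (r • f.1) (x, y, z) = r • homogeneousFun₂ X f.1 (x, y, z)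
  simp only [homogeneousFun₂_apply, ContinuousMap.smul_apply, smul_sub, smul_add]

/-- **`d F = 0`** for the homogeneous cochain of an inhomogeneous `2`-cocycle (a formal
cancellation). [folklore] -/
theorem d_toTwoCochain (f : contTwoCocycles X) :
    (homogeneousCochains X).d 2 3 (toTwoCochain X f) = 0 := by
  apply Subtype.ext
  have h := homogeneousCochains.d_apply X 2 (toTwoCochain X f)
  change (((homogeneousCochains X).d 2 3 (toTwoCochain X f) : (homogeneousCochains X).X 3) :
    C(G, C(G, C(G, C(G, X))))) = (d X 3).hom (nest₃ X (homogeneousFun₂ X f.1)) at h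
  rw [h]
  ext x y z w
  rw [d_three_hom_apply, nest₃_apply, nest₃_apply, nest₃_apply, nest₃_apply,
    homogeneousFun₂_apply, homogeneousFun₂_apply, homogeneousFun₂_apply, homogeneousFun₂_apply]
  change _ = (0 : X)
  abel

/-- The class **`[f] ∈ H²_cont(G, X)`** of a continuous inhomogeneous `2`-cocycle.
Ref: Serre, *Galois Cohomology*, I §2.2. [folklore] -/
def twoCocycleClass (f : contTwoCocycles X) : continuousCohomology 2 X :=
  cxClass (homogeneousCochains X) 2 3 up_nat_next_two (toTwoCochain X f) (d_toTwoCochain X f)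

/-- Additivity of `twoCocycleClass`. [folklore] -/
theorem twoCocycleClass_add (f g : contTwoCocycles X) :
    twoCocycleClass X (f + g) = twoCocycleClass X f + twoCocycleClass X g := by
  unfold twoCocycleClass
  rw [← cxClass_add]
  exact cxClass_congr (toTwoCochain_add X f g)

/-- Linearity of `twoCocycleClass`. [folklore] -/
theorem twoCocycleClass_smul (r : R) (f : contTwoCocycles X) :
    twoCocycleClass X (r • f) = r • twoCocycleClass X f := by
  unfold twoCocycleClass
  rw [← cxClass_smul]
  exact cxClass_congr (toTwoCochain_smul X r f)

/-- The class map `Z²_cont(G, X) → H²_cont(G, X)` as an `R`-linear map. [folklore] -/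
def twoCocycleClassₗ : contTwoCocycles X →ₗ[R] continuousCohomology 2 X where
  toFun := twoCocycleClass X
  map_add' := twoCocycleClass_add X
  map_smul' := twoCocycleClass_smul X

/-- Unfolding `twoCocycleClassₗ`. [folklore] -/
@[simp] theorem twoCocycleClassₗ_apply (f : contTwoCocycles X) :
    twoCocycleClassₗ X f = twoCocycleClass X f := rfl

/-- The zero cocycle has zero class. [folklore] -/
theorem twoCocycleClass_zero : twoCocycleClass X 0 = 0 := (twoCocycleClassₗ X).map_zero

/-- `twoCocycleClass` respects subtraction. [folklore] -/
theorem twoCocycleClass_sub (f g : contTwoCocycles X) :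
    twoCocycleClass X (f - g) = twoCocycleClass X f - twoCocycleClass X g :=
  (twoCocycleClassₗ X).map_sub f g

/-- `twoCocycleClass` respects negation. [folklore] -/
theorem twoCocycleClass_neg (f : contTwoCocycles X) :
    twoCocycleClass X (-f) = -twoCocycleClass X f :=
  (twoCocycleClassₗ X).map_neg f

/-- The inhomogeneous cochain `(σ, τ) ↦ F(1, σ, στ)` of a homogeneous `2`-cochain `F`, as a
continuous map (evaluation is jointly continuous, `G` being locally compact). [folklore] -/
def inhomogeneousFun₂ (F : C(G, C(G, C(G, X)))) : C(G × G, X) :=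
  ((F 1).uncurry).comp ⟨fun p : G × G => (p.1, p.1 * p.2), by fun_prop⟩

omit [IsTopologicalGroup G] in
/-- Unfolding `inhomogeneousFun₂`. [folklore] -/
@[simp] theorem inhomogeneousFun₂_apply [IsTopologicalGroup G] (F : C(G, C(G, C(G, X))))
    (σ τ : G) : inhomogeneousFun₂ X F (σ, τ) = F 1 σ (σ * τ) := rfl

/-- **Every class in `H²_cont(G, X)` is the class of a continuous inhomogeneous `2`-cocycle**
(namely of `f(σ, τ) = F(1, σ, στ)` for an invariant homogeneous cocycle `F` representing it).
Ref: Serre, *Cohomologie galoisienne*, I §2.3: "`H²(G, A)` est le groupe des classes de systèmes de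
facteurs continus de `G` dans `A`". [cite: SerreGaloisCohomology1997, I §2.3] -/
theorem twoCocycleClass_surjective : Function.Surjective (twoCocycleClass X) := by
  intro γ
  obtain ⟨F, hF, rfl⟩ := cxClass_surjective (homogeneousCochains X) 2 3 up_nat_next_two γ
  -- the cocycle identity of `F`
  have hcoc : ∀ x y z w, F.1 y z w - (F.1 x z w - (F.1 x y w - F.1 x y z)) = 0 := by
    intro x y z w
    have h := homogeneousCochains.d_apply X 2 F
    change (((homogeneousCochains X).d 2 3 F : (homogeneousCochains X).X 3) :
      C(G, C(G, C(G, C(G, X))))) = (d X 3).hom F.1 at h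
    rw [hF] at h
    have h' := congrArg (fun Φ : C(G, C(G, C(G, C(G, X)))) => Φ x y z w) h
    exact h'.symm
  -- invariance of `F`
  have hinv : ∀ g x y z, X.ρ g (F.1 (g⁻¹ * x) (g⁻¹ * y) (g⁻¹ * z)) = F.1 x y z :=
    fun g x y z => congrArg (fun Φ : C(G, C(G, C(G, X))) => Φ x y z) (F.2 g)
  have hf : inhomogeneousFun₂ X F.1 ∈ contTwoCocycles X := by
    intro σ τ υ
    simp only [inhomogeneousFun₂_apply, mul_assoc]
    have h1 := hinv σ σ (σ * τ) (σ * (τ * υ))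
    rw [inv_mul_cancel, inv_mul_cancel_left, inv_mul_cancel_left] at h1
    have h2 := hcoc 1 σ (σ * τ) (σ * (τ * υ))
    rw [← h1] at h2
    rw [← sub_eq_zero, ← h2]
    abel
  refine ⟨⟨inhomogeneousFun₂ X F.1, hf⟩, cxClass_congr (Subtype.ext ?_)⟩
  refine ContinuousMap.ext fun x => ContinuousMap.ext fun y => ContinuousMap.ext fun z => ?_
  rw [toTwoCochain_apply]
  simp only [inhomogeneousFun₂_apply, mul_inv_cancel_left]
  have h := hcoc 1 x y z
  rw [sub_eq_zero] at h
  rw [h]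
  abel

/-- **A continuous `2`-cocycle has trivial class iff it is the coboundary of a continuous
`1`-cochain**: `[f] = 0 ↔ ∃ b : C(G, X), f(σ, τ) = σ b(τ) - b(στ) + b(σ)`.
Ref: Serre, *Cohomologie galoisienne*, I §2.3 (classes of continuous factor systems);
Neukirch–Schmidt–Wingberg (2008), I §2. [cite: SerreGaloisCohomology1997, I §2.3] -/
theorem twoCocycleClass_eq_zero_iff (f : contTwoCocycles X) :
    twoCocycleClass X f = 0 ↔
      ∃ b : C(G, X), ∀ σ τ : G, f.1 (σ, τ) = X.ρ σ (b τ) - b (σ * τ) + b σ := by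
  unfold twoCocycleClass
  rw [cxClass_eq_zero_iff _ 2 3 up_nat_next_two 1 up_nat_prev_two]
  constructor
  · rintro ⟨T, hT⟩
    refine ⟨T.1 1, fun σ τ => ?_⟩
    have h1 := congrArg (fun s : (homogeneousCochains X).X 2 =>
      (s.1 : C(G, C(G, C(G, X)))) 1 σ (σ * τ)) hT
    simp only at h1
    rw [ContPairing.d_one_two_apply, toTwoCochain_apply, inv_mul_cancel_left, inv_one, one_mul,
      one_mul, contTwoCocycles.apply_one_left f (σ * τ), contTwoCocycles.apply_one_left f σ,
      sub_add_cancel] at h1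
    -- `T σ (στ) = σ T(1, τ)` by invariance
    have h2 : (T.1 : C(G, C(G, X))) σ (σ * τ) = X.ρ σ ((T.1 : C(G, C(G, X))) 1 τ) := by
      have h := congrArg (fun Φ : C(G, C(G, X)) => Φ σ (σ * τ)) (T.2 σ)
      simp only at h
      rw [← h, resolutionX_two_ρ_apply, inv_mul_cancel, inv_mul_cancel_left]
    rw [← h1, h2]
    abel
  · rintro ⟨b, hb⟩
    let H : C(G × G, X) :=
      ⟨fun p => f.1 (p.1, p.1⁻¹ * p.2) + b p.2 - b p.1, by fun_prop⟩
    have hH : ∀ x y, H (x, y) = f.1 (x, x⁻¹ * y) + b y - b x := fun _ _ => rfl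
    have hH' : ∀ x y, H (x, y) = X.ρ x (b (x⁻¹ * y)) := fun x y => by
      rw [hH, hb, mul_inv_cancel_left]
      abel
    have hHinv : ∀ (s x y : G), X.ρ s (H (s⁻¹ * x, s⁻¹ * y)) = H (x, y) := by
      intro s x y
      rw [hH', hH', inv_mul_inv_mul_inv_mul, ← ContinuousLinearMap.comp_apply,
        ← ContinuousLinearMap.mul_def, ← map_mul, mul_inv_cancel_left]
    refine ⟨ContPairing.oneCochainOfFun H hHinv, Subtype.ext ?_⟩
    refine ContinuousMap.ext fun x => ContinuousMap.ext fun y => ContinuousMap.ext fun z => ?_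
    rw [ContPairing.d_one_two_apply, ContPairing.oneCochainOfFun_apply,
      ContPairing.oneCochainOfFun_apply, ContPairing.oneCochainOfFun_apply, toTwoCochain_apply,
      hH, hH, hH]
    abel

/-! ### Functoriality -/

variable {H : Type v} [Group H] [TopologicalSpace H] [IsTopologicalGroup H] [LocallyCompactSpace H]
  {Y : TopRep.{v} R H}

omit [LocallyCompactSpace G] in
variable {X} in
/-- Pulling back a continuous `2`-cocycle along a compatible pair `(θ : H → G, φ : X → Y)`:
`(σ, τ) ↦ φ (f (θ σ, θ τ))`. Ref: Serre, *Galois Cohomology*, I §2.4. [folklore] -/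
def contTwoCocycles.pullback (θ : H →ₜ* G) (φ : res (θ : H →* G) X ⟶ Y)
    (f : contTwoCocycles X) : contTwoCocycles Y :=
  ⟨(φ.hom : C(X, Y)).comp (f.1.comp ((θ : C(H, G)).prodMap (θ : C(H, G)))), fun σ τ υ => by
    change Y.ρ σ (φ.hom (f.1 (θ τ, θ υ))) + φ.hom (f.1 (θ σ, θ (τ * υ))) =
      φ.hom (f.1 (θ (σ * τ), θ υ)) + φ.hom (f.1 (θ σ, θ τ))
    rw [map_mul, map_mul, ← TopRep.hom_comm_apply φ σ, ← map_add, ← map_add]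
    exact congrArg φ.hom (f.2 (θ σ) (θ τ) (θ υ))⟩

omit [IsTopologicalGroup G] [IsTopologicalGroup H] [LocallyCompactSpace G]
  [LocallyCompactSpace H] in
/-- Unfolding `contTwoCocycles.pullback`. [folklore] -/
@[simp] theorem contTwoCocycles.pullback_apply (θ : H →ₜ* G) (φ : res (θ : H →* G) X ⟶ Y)
    (f : contTwoCocycles X) (σ τ : H) :
    (contTwoCocycles.pullback θ φ f).1 (σ, τ) = φ.hom (f.1 (θ σ, θ τ)) := rfl

/-- **Functoriality of `H²` on explicit cocycles**: Mathlib's `ContinuousCohomology.map θ φ 2`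
sends `[f]` to `[φ ∘ f ∘ (θ × θ)]`. Ref: Serre, *Galois Cohomology*, I §2.4.
[cite: SerreGaloisCohomology1997, I §2.4] -/
theorem map_twoCocycleClass (θ : H →ₜ* G) (φ : res (θ : H →* G) X ⟶ Y)
    (f : contTwoCocycles X) :
    ContinuousCohomology.map θ φ 2 (twoCocycleClass X f) =
      twoCocycleClass Y (contTwoCocycles.pullback θ φ f) := by
  unfold twoCocycleClass ContinuousCohomology.map
  refine homologyMap_cxClass _ 2 3 up_nat_next_two _ _ _ _ (Subtype.ext ?_)
  refine ContinuousMap.ext fun x => ContinuousMap.ext fun y => ContinuousMap.ext fun z => ?_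
  change (contTwoCocycles.pullback θ φ f).1 (y, y⁻¹ * z) -
      (contTwoCocycles.pullback θ φ f).1 (x, x⁻¹ * z) +
      (contTwoCocycles.pullback θ φ f).1 (x, x⁻¹ * y) =
    φ.hom (f.1 (θ y, (θ y)⁻¹ * θ z) - f.1 (θ x, (θ x)⁻¹ * θ z) + f.1 (θ x, (θ x)⁻¹ * θ y))
  simp only [contTwoCocycles.pullback_apply, map_mul, map_inv, map_sub, map_add]

end TwoCocycles

/-! ### The cup product of crossed homomorphisms as an inhomogeneous `2`-cocycle -/

namespace ContPairing

variable {R : Type u} [CommRing R] [TopologicalSpace R]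
variable {G : Type v} [Group G] [TopologicalSpace G] [IsTopologicalGroup G] [LocallyCompactSpace G]
variable {X Y Z : TopRep.{v} R G} (φ : ContPairing X Y Z)

omit [LocallyCompactSpace G] in
/-- The inhomogeneous cup product `2`-cocycle **`(σ, τ) ↦ ⟨f σ, σ g τ⟩ = ⟨f σ, g(στ) - g σ⟩`** of two
continuous crossed homomorphisms.
Ref: Neukirch–Schmidt–Wingberg, *Cohomology of Number Fields* (2008), I §4 (cup product on
inhomogeneous cochains, `(a ∪ b)(σ, τ) = a(σ) ⊗ σ b(τ)` in bidegree `(1, 1)`). [folklore] -/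
def cupCocycle (f : contOneCocycles X) (g : contOneCocycles Y) : contTwoCocycles Z :=
  ⟨⟨fun p => φ.toLin (f.1 p.1) (g.1 (p.1 * p.2) - g.1 p.1),
      φ.continuous_toLin.comp ((f.1.continuous.comp continuous_fst).prodMk
        ((g.1.continuous.comp (continuous_fst.mul continuous_snd)).sub
          (g.1.continuous.comp continuous_fst)))⟩, fun σ τ υ => by
    change Z.ρ σ (φ.toLin (f.1 τ) (g.1 (τ * υ) - g.1 τ)) +
        φ.toLin (f.1 σ) (g.1 (σ * (τ * υ)) - g.1 σ) =
      φ.toLin (f.1 (σ * τ)) (g.1 (σ * τ * υ) - g.1 (σ * τ)) +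
        φ.toLin (f.1 σ) (g.1 (σ * τ) - g.1 σ)
    have hf : f.1 (σ * τ) = f.1 σ + X.ρ σ (f.1 τ) := f.2 σ τ
    have hg1 : g.1 (σ * τ) = g.1 σ + Y.ρ σ (g.1 τ) := g.2 σ τ
    have hg2 : g.1 (σ * (τ * υ)) = g.1 σ + Y.ρ σ (g.1 (τ * υ)) := g.2 σ (τ * υ)
    have hg3 : g.1 (σ * τ * υ) = g.1 σ + Y.ρ σ (g.1 (τ * υ)) := by
      rw [mul_assoc]; exact g.2 σ (τ * υ)
    rw [← φ.toLin_smul, hf, hg3, hg1, hg2]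
    simp only [map_sub, map_add, LinearMap.add_apply]
    abel⟩

omit [LocallyCompactSpace G] in
/-- Unfolding `cupCocycle`. [folklore] -/
@[simp] theorem cupCocycle_apply (f : contOneCocycles X) (g : contOneCocycles Y) (σ τ : G) :
    (φ.cupCocycle f g).1 (σ, τ) = φ.toLin (f.1 σ) (g.1 (σ * τ) - g.1 σ) := rfl

omit [LocallyCompactSpace G] in
/-- `(f ∪ g)(σ, τ) = ⟨f σ, σ g τ⟩`. [folklore] -/
theorem cupCocycle_apply_eq_smul (f : contOneCocycles X) (g : contOneCocycles Y) (σ τ : G) :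
    (φ.cupCocycle f g).1 (σ, τ) = φ.toLin (f.1 σ) (Y.ρ σ (g.1 τ)) := by
  rw [cupCocycle_apply, ← contOneCocycles.apply_smul_inv_mul g σ (σ * τ), inv_mul_cancel_left]

/-- **The homogeneous cup-product cochain `(x, y, z) ↦ ⟨f y - f x, g z - g y⟩` of the tree's
`ContPairing.cupTwoCochain` is the homogeneous cochain of the inhomogeneous cocycle
`(σ, τ) ↦ ⟨f σ, σ g τ⟩`** (equality of cochains, by bilinearity). [folklore] -/
theorem cupTwoCochain_eq_toTwoCochain (f : contOneCocycles X) (g : contOneCocycles Y) :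
    φ.cupTwoCochain f g = toTwoCochain Z (φ.cupCocycle f g) := by
  refine Subtype.ext (ContinuousMap.ext fun x => ContinuousMap.ext fun y =>
    ContinuousMap.ext fun z => ?_)
  rw [cupTwoCochain_apply, toTwoCochain_apply, cupCocycle_apply, cupCocycle_apply,
    cupCocycle_apply, mul_inv_cancel_left, mul_inv_cancel_left, mul_inv_cancel_left]
  simp only [map_sub, LinearMap.sub_apply]
  abel

/-- **`[f ∪ g]` is the class of the inhomogeneous `2`-cocycle `(σ, τ) ↦ ⟨f σ, σ g τ⟩.**
[folklore] -/
theorem cupClass_eq_twoCocycleClass (f : contOneCocycles X) (g : contOneCocycles Y) :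
    φ.cupClass f g = twoCocycleClass Z (φ.cupCocycle f g) := by
  unfold cupClass twoCocycleClass
  exact cxClass_congr (φ.cupTwoCochain_eq_toTwoCochain f g)

/-- The cup product of two degree-one classes, on crossed-homomorphism representatives, is the
class of `(σ, τ) ↦ ⟨f σ, σ g τ⟩`. [folklore] -/
theorem cupProduct_oneCocycleClass_eq_twoCocycleClass (f : contOneCocycles X)
    (g : contOneCocycles Y) :
    φ.cupProduct (oneCocycleClass X f) (oneCocycleClass Y g) =
      twoCocycleClass Z (φ.cupCocycle f g) := by
  rw [cupProduct_oneCocycleClass, cupClass_eq_twoCocycleClass]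

end ContPairing

end Literature.NumberTheory.GaloisRepresentations

end
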